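import Literature.Topology.FourManifolds.ComplexProjectiveSpace
import Literature.AlgebraicTopology.Homotopy.PiThreeSphereTwo
import Literature.AlgebraicTopology.Homotopy.HomologyWeakEquivalence
import HarnessLib

/-!
# The circle bundle `S¹ → S²ⁿ⁺¹ → ℂℙⁿ` and the homotopy groups of `ℂℙⁿ`

Topic `Literature/Topology/FourManifolds` (home of the tree's `ComplexProjectiveSpace n`).
A. Hatcher, *Algebraic Topology* (2002), §4.2, Example 4.44 / Example 4.50 ("the map
`S²ⁿ⁺¹ → ℂPⁿ`, `(z₀, …, zₙ) ↦ [z₀, …, zₙ]` … is a fiber bundle with fiber `S¹`"; p. 380 and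
Example 4.50: "from the long exact sequence of homotopy groups for the bundle `S¹ → S^∞ → ℂP^∞`
… more generally `S¹ → S²ⁿ⁺¹ → ℂPⁿ` gives `πᵢ(ℂPⁿ) ≅ πᵢ(S²ⁿ⁺¹)` for `i ≥ 3` and `π₂(ℂPⁿ) ≅ ℤ`"),
with Thm. 4.41 (long exact sequence of a Serre fibration) and Prop. 4.48 (bundles are Serre
fibrations). For the tree's `ComplexProjectiveSpace n = ℙ(ℂⁿ⁺¹)` and the unit sphere
`unitSphere n ⊂ EuclideanSpace ℂ (Fin (n + 1))` (a round `S²ⁿ⁺¹`) we construct and PROVE: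

* `CircleBundle.proj : C(S²ⁿ⁺¹, ℂℙⁿ)`, `x ↦ [x]`, onto (`proj_surjective`), constant on the orbits
  of the circle action `CircleBundle.act` (`proj_act`);
* for each `i`, the section `CircleBundle.sec i` over the affine chart domain `Uᵢ = {vᵢ ≠ 0}`
  (the unit representative with `i`-th coordinate real positive) and the local trivialisation
  `CircleBundle.triv i : proj⁻¹ Uᵢ ≃ₜ Uᵢ × S¹`, `x ↦ ([x], xᵢ/|xᵢ|)`, over `Uᵢ`;
* `CircleBundle.isFibreBundleWith : IsFibreBundleWith Circle proj` (Hatcher Example 4.44) and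
  `CircleBundle.isSerreFibration` (Prop. 4.48);
* the consequences of the long exact sequence (Thm. 4.41) with `πₖ(S¹) = 0` (`k ≥ 2`) and
  `πₖ(S²ⁿ⁺¹) = 0` (`k ≤ 2n`, general position, `subsingleton_homotopyGroup_sphere`):
  `CircleBundle.bijective_homotopyGroupMap_proj` (`|N| ≥ 3`), `…injective…` (`|N| ≥ 2`),
  **`ComplexProjectiveSpace.subsingleton_homotopyGroup`** — `πₖ(ℂℙⁿ, p) = 0` for `3 ≤ k ≤ 2n`
  at every `p` — and **`ComplexProjectiveSpace.nonempty_mulEquiv_pi_two_int`** —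
  `π₂(ℂℙⁿ, p) ≃* ℤ` for `n ≥ 1` at every `p` (`∂ : π₂(ℂℙⁿ) ≅ π₁(S¹) ≅ ℤ`);
* `ComplexProjectiveSpace.instPathConnectedSpace` (image of the sphere).

Everything is proved (definitions are the bundle data). The pattern (and the phase/`S¹` API) is
that of the tree's Hopf bundle `HopfFibration.lean` (the case `n = 1` in real coordinates).

## References

* A. Hatcher, *Algebraic Topology*, CUP (2002), §4.2: Example 4.44 (p. 377), p. 380,
  Example 4.50, Thm. 4.41, Prop. 4.48, Cor. 4.9. [HatcherAT2002]
-/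

noncomputable section

open Set Metric Function Complex Topology
open scoped ComplexConjugate

namespace Literature.Topology.FourManifolds

open Literature.AlgebraicTopology.Homotopy Literature.AlgebraicTopology.Homotopy.HopfFibration

namespace ComplexProjectiveSpace

variable {n : ℕ}

/-- `ℂⁿ⁺¹` with its Hermitian (`ℓ²`) norm. [folklore] -/
abbrev Vec (n : ℕ) : Type := EuclideanSpace ℂ (Fin (n + 1))

/-- The unit sphere `S²ⁿ⁺¹ ⊂ ℂⁿ⁺¹`. [folklore] -/
abbrev unitSphere (n : ℕ) : Set (Vec n) := Metric.sphere (0 : Vec n) 1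

namespace CircleBundle

/-! ### The projection `S²ⁿ⁺¹ → ℂℙⁿ` and the circle action -/

/-- A unit vector is nonzero (as a function). [folklore] -/
theorem ofLp_ne_zero (x : unitSphere n) : (WithLp.ofLp (x : Vec n) : Fin (n + 1) → ℂ) ≠ 0 := by
  intro h
  have hx : (x : Vec n) = 0 := (WithLp.ofLp_injective 2) (by rw [h]; rfl)
  exact ne_zero_of_mem_unit_sphere x hx

/-- **The bundle projection** `S²ⁿ⁺¹ → ℂℙⁿ`, `x ↦ [x]` (Hatcher 2002, Example 4.44).
[cite: HatcherAT2002, Example 4.44] -/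
def proj : C(unitSphere n, ComplexProjectiveSpace n) :=
  ⟨fun x => mk ⟨WithLp.ofLp (x : Vec n), ofLp_ne_zero x⟩,
    continuous_mk.comp (((PiLp.continuous_ofLp 2 _).comp continuous_subtype_val).subtype_mk _)⟩

/-- `proj x = [x]`. [folklore] -/
theorem proj_apply (x : unitSphere n) : proj x = mk ⟨WithLp.ofLp (x : Vec n), ofLp_ne_zero x⟩ := rfl

/-- The unit vector of a nonzero vector. [folklore] -/
def normalize (v : {v : Fin (n + 1) → ℂ // v ≠ 0}) : unitSphere n :=
  ⟨(‖WithLp.toLp 2 (v : Fin (n + 1) → ℂ)‖⁻¹ : ℝ) • WithLp.toLp 2 (v : Fin (n + 1) → ℂ), by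
    have hv : WithLp.toLp 2 (v : Fin (n + 1) → ℂ) ≠ (0 : Vec n) := fun h => v.2 (by
      have := congrArg WithLp.ofLp h; simpa using this)
    simp [norm_smul, inv_mul_cancel₀ (norm_ne_zero_iff.2 hv)]⟩

/-- `[normalize v] = [v]`. [folklore] -/
theorem proj_normalize (v : {v : Fin (n + 1) → ℂ // v ≠ 0}) : proj (normalize v) = mk v := by
  rw [proj_apply]
  refine (mk_eq_mk_iff _ _).2 ⟨((‖WithLp.toLp 2 (v : Fin (n + 1) → ℂ)‖⁻¹ : ℝ) : ℂ), ?_⟩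
  change _ = WithLp.ofLp (((‖WithLp.toLp 2 (v : Fin (n + 1) → ℂ)‖⁻¹ : ℝ)) • WithLp.toLp 2 (v : Fin (n + 1) → ℂ))
  rw [WithLp.ofLp_smul, WithLp.ofLp_toLp, Complex.coe_smul]

/-- **`proj` is onto**: every point of `ℂℙⁿ` is the class of a unit vector. [folklore] -/
theorem proj_surjective : Surjective (proj (n := n)) := fun p => by
  induction p using ind with
  | h v => exact ⟨normalize v, proj_normalize v⟩

/-- **The circle action** `u · x = u x` on `S²ⁿ⁺¹`, whose orbits are the fibres of `proj`
(Hatcher 2002, Example 4.44). [cite: HatcherAT2002, Example 4.44] -/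
def act (u : Circle) (x : unitSphere n) : unitSphere n :=
  ⟨(u : ℂ) • (x : Vec n), by
    rw [mem_sphere_zero_iff_norm, norm_smul, Circle.norm_coe, one_mul, norm_eq_of_mem_sphere x]⟩

/-- The action on coordinates. [folklore] -/
@[simp] theorem coe_act (u : Circle) (x : unitSphere n) : ((act u x : unitSphere n) : Vec n) = (u : ℂ) • (x : Vec n) := rfl

/-- The circle action is jointly continuous. [folklore] -/
theorem continuous_act : Continuous fun p : Circle × unitSphere n => act p.1 p.2 :=
  ((continuous_subtype_val.comp continuous_fst).smul
    (continuous_subtype_val.comp continuous_snd)).subtype_mk _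

/-- **`proj` is constant on orbits**: `[u x] = [x]`. [cite: HatcherAT2002, Example 4.44] -/
theorem proj_act (u : Circle) (x : unitSphere n) : proj (act u x) = proj x :=
  (mk_eq_mk_iff _ _).2 ⟨u, by
    change (u : ℂ) • WithLp.ofLp (x : Vec n) = WithLp.ofLp ((u : ℂ) • (x : Vec n))
    rw [WithLp.ofLp_smul]⟩

/-! ### The charts `Uᵢ = {vᵢ ≠ 0}` and the sections over them -/

/-- The `i`-th chart domain `Uᵢ = {[v] | vᵢ ≠ 0}`. [folklore] -/
abbrev U (i : Fin (n + 1)) : Set (ComplexProjectiveSpace n) := {p | CoordNeZero i p}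

/-- `[x] ∈ Uᵢ ↔ xᵢ ≠ 0`. [folklore] -/
theorem proj_mem_U_iff (i : Fin (n + 1)) (x : unitSphere n) : proj x ∈ U i ↔ (x : Vec n) i ≠ 0 :=
  Iff.rfl

/-- The representative of `[v]` with `i`-th coordinate `1` (junk `0` off `Uᵢ`): `vᵢ⁻¹ v`.
[folklore] -/
def dirVec (i : Fin (n + 1)) : ComplexProjectiveSpace n → (Fin (n + 1) → ℂ) :=
  Projectivization.lift (fun v => ((v : Fin (n + 1) → ℂ) i)⁻¹ • (v : Fin (n + 1) → ℂ)) (by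
    rintro a b t h
    have ht : t ≠ 0 := by rintro rfl; exact a.2 (by simpa using h)
    rw [h]
    rcases eq_or_ne ((b : Fin (n + 1) → ℂ) i) 0 with hb | hb
    · simp [hb]
    · rw [Pi.smul_apply, smul_eq_mul, mul_inv, smul_smul]
      congr 1
      field_simp)

/-- `dirVec i [v] = vᵢ⁻¹ v`. [folklore] -/
@[simp] theorem dirVec_mk (i : Fin (n + 1)) (v : {v : Fin (n + 1) → ℂ // v ≠ 0}) :
    dirVec i (mk v) = ((v : Fin (n + 1) → ℂ) i)⁻¹ • (v : Fin (n + 1) → ℂ) := rfl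

/-- On `Uᵢ` the `i`-th coordinate of `dirVec i` is `1`. [folklore] -/
theorem dirVec_apply_self (i : Fin (n + 1)) {p : ComplexProjectiveSpace n} (hp : p ∈ U i) :
    dirVec i p i = 1 := by
  induction p using ind with
  | h v => rw [dirVec_mk, Pi.smul_apply, smul_eq_mul, inv_mul_cancel₀ hp]

/-- On `Uᵢ`, `dirVec i p ≠ 0`. [folklore] -/
theorem dirVec_ne_zero (i : Fin (n + 1)) {p : ComplexProjectiveSpace n} (hp : p ∈ U i) :
    dirVec i p ≠ 0 := fun h => by
  have := dirVec_apply_self i hp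
  rw [h] at this
  exact one_ne_zero this.symm

/-- `[dirVec i p] = p` on `Uᵢ`. [folklore] -/
theorem mk_dirVec (i : Fin (n + 1)) {p : ComplexProjectiveSpace n} (hp : p ∈ U i) :
    mk ⟨dirVec i p, dirVec_ne_zero i hp⟩ = p := by
  induction p using ind with
  | h v => exact (mk_eq_mk_iff _ _).2 ⟨((v : Fin (n + 1) → ℂ) i)⁻¹, rfl⟩

/-- `dirVec i` is continuous on `Uᵢ`. [folklore] -/
theorem continuousOn_dirVec (i : Fin (n + 1)) : ContinuousOn (dirVec (n := n) i) (U i) := by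
  refine continuousOn_of_comp_mk (isOpen_setOf_coordNeZero i) ?_
  have hc : ContinuousOn (fun v : {v : Fin (n + 1) → ℂ // v ≠ 0} =>
      ((v : Fin (n + 1) → ℂ) i)⁻¹ • (v : Fin (n + 1) → ℂ)) (mk ⁻¹' U i) :=
    ((((continuous_apply i).comp continuous_subtype_val).continuousOn).inv₀
      (fun v hv => hv)).smul continuous_subtype_val.continuousOn
  exact hc

/-- The `ℓ²` vector of `dirVec`. [folklore] -/
def dirLp (i : Fin (n + 1)) (p : ComplexProjectiveSpace n) : Vec n := WithLp.toLp 2 (dirVec i p)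

/-- On `Uᵢ`, `dirLp i p ≠ 0`. [folklore] -/
theorem dirLp_ne_zero (i : Fin (n + 1)) {p : ComplexProjectiveSpace n} (hp : p ∈ U i) :
    dirLp i p ≠ 0 := fun h => dirVec_ne_zero i hp (by
  have := congrArg WithLp.ofLp h; simpa [dirLp] using this)

/-- `dirLp i` is continuous on `Uᵢ`. [folklore] -/
theorem continuousOn_dirLp (i : Fin (n + 1)) : ContinuousOn (dirLp (n := n) i) (U i) :=
  (PiLp.continuous_toLp 2 _).comp_continuousOn (continuousOn_dirVec i)

/-- **The section over `Uᵢ`**: the unit representative of `p` whose `i`-th coordinate is real and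
positive, `p ↦ dirVec i p / ‖dirVec i p‖` (junk off `Uᵢ`). [cite: HatcherAT2002, Example 4.44] -/
def secVec (i : Fin (n + 1)) (p : ComplexProjectiveSpace n) : Vec n :=
  (‖dirLp i p‖⁻¹ : ℝ) • dirLp i p

/-- The section lands on the sphere over `Uᵢ`. [folklore] -/
theorem secVec_mem (i : Fin (n + 1)) {p : ComplexProjectiveSpace n} (hp : p ∈ U i) :
    secVec i p ∈ unitSphere n := by
  rw [mem_sphere_zero_iff_norm, secVec, norm_smul, norm_inv, norm_norm,
    inv_mul_cancel₀ (norm_ne_zero_iff.2 (dirLp_ne_zero i hp))]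

/-- `secVec i` is continuous on `Uᵢ`. [folklore] -/
theorem continuousOn_secVec (i : Fin (n + 1)) : ContinuousOn (secVec (n := n) i) (U i) :=
  ((continuous_norm.comp_continuousOn (continuousOn_dirLp i)).inv₀
    (fun _ hp => norm_ne_zero_iff.2 (dirLp_ne_zero i hp))).smul (continuousOn_dirLp i)

/-- The `i`-th coordinate of the section is the positive real `‖dirLp i p‖⁻¹`. [folklore] -/
theorem secVec_apply_self (i : Fin (n + 1)) {p : ComplexProjectiveSpace n} (hp : p ∈ U i) :
    secVec i p i = ((‖dirLp i p‖⁻¹ : ℝ) : ℂ) := by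
  rw [secVec]
  change ((‖dirLp i p‖⁻¹ : ℝ) : ℂ) • (dirLp i p) i = _
  have : (dirLp i p) i = dirVec i p i := rfl
  rw [this, dirVec_apply_self i hp, smul_eq_mul, mul_one]

/-- The section as a map `Uᵢ → S²ⁿ⁺¹`. [cite: HatcherAT2002, Example 4.44] -/
def sec (i : Fin (n + 1)) (p : U i) : unitSphere n := ⟨secVec i p, secVec_mem i p.2⟩

/-- `sec i` is continuous. [folklore] -/
theorem continuous_sec (i : Fin (n + 1)) : Continuous (sec (n := n) i) :=
  ((continuousOn_secVec i).comp_continuous continuous_subtype_val (fun p => p.2)).subtype_mk _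

/-- **`proj ∘ sec i = 𝟙`** on `Uᵢ`. [cite: HatcherAT2002, Example 4.44] -/
theorem proj_sec (i : Fin (n + 1)) (p : U i) : proj (sec i p) = p := by
  rw [proj_apply, ← mk_dirVec i p.2]
  refine (mk_eq_mk_iff _ _).2 ⟨((‖dirLp i p‖⁻¹ : ℝ) : ℂ), ?_⟩
  change _ = WithLp.ofLp (((‖dirLp i (p : ComplexProjectiveSpace n)‖⁻¹ : ℝ)) • dirLp i p)
  rw [WithLp.ofLp_smul, Complex.coe_smul]
  rfl

/-! ### The local trivialisations -/

/-- `xᵢ ≠ 0` over `Uᵢ`. [folklore] -/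
theorem coord_ne_zero {i : Fin (n + 1)} (x : ↥(proj ⁻¹' U i)) : ((x : unitSphere n) : Vec n) i ≠ 0 := x.2

/-- The trivialisation `proj⁻¹ Uᵢ → Uᵢ × S¹`, `x ↦ ([x], xᵢ/|xᵢ|)`. [cite: HatcherAT2002, Example 4.44] -/
def trivFun (i : Fin (n + 1)) (x : ↥(proj ⁻¹' U i)) : ↥(U i) × Circle :=
  (⟨proj x, x.2⟩, phase (((x : unitSphere n) : Vec n) i) (coord_ne_zero x))

/-- Its inverse `Uᵢ × S¹ → proj⁻¹ Uᵢ`, `(p, u) ↦ u · secᵢ p`. [cite: HatcherAT2002, Example 4.44] -/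
def trivInv (i : Fin (n + 1)) (q : ↥(U i) × Circle) : ↥(proj ⁻¹' U i) :=
  ⟨act q.2 (sec i q.1), by
    change proj (act q.2 (sec i q.1)) ∈ U i
    rw [proj_act, proj_sec]; exact q.1.2⟩

/-- On the sphere, `dirLp i [x] = xᵢ⁻¹ x`. [folklore] -/
theorem dirLp_proj (i : Fin (n + 1)) (x : unitSphere n) :
    dirLp i (proj x) = (((x : Vec n) i)⁻¹ : ℂ) • (x : Vec n) := by
  apply (WithLp.ofLp_injective 2).eq_iff.1
  change dirVec i (proj x) = WithLp.ofLp ((((x : Vec n) i)⁻¹ : ℂ) • (x : Vec n))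
  rw [proj_apply, dirVec_mk, WithLp.ofLp_smul]

/-- On the sphere over `Uᵢ`, `secᵢ [x] = (|xᵢ|/xᵢ) x`. [folklore] -/
theorem secVec_proj (i : Fin (n + 1)) (x : unitSphere n) :
    secVec i (proj x) = ((‖(x : Vec n) i‖ : ℂ) * (((x : Vec n) i)⁻¹ : ℂ)) • (x : Vec n) := by
  rw [secVec, dirLp_proj, norm_smul, norm_inv, norm_eq_of_mem_sphere x, mul_one, inv_inv,
    ← Complex.coe_smul, smul_smul]

/-- `(p, u) ↦ u · secᵢ p` is a left inverse of `x ↦ ([x], xᵢ/|xᵢ|)`. [folklore] -/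
theorem triv_left_inv (i : Fin (n + 1)) (x : ↥(proj ⁻¹' U i)) : trivInv i (trivFun i x) = x := by
  apply Subtype.ext; apply Subtype.ext
  have hx := coord_ne_zero x
  change (phase (((x : unitSphere n) : Vec n) i) hx : ℂ) • secVec i (proj (x : unitSphere n)) =
    ((x : unitSphere n) : Vec n)
  rw [secVec_proj i, smul_smul, ← mul_assoc, phase_mul_norm, mul_inv_cancel₀ hx, one_smul]

/-- … and a right inverse: `[u · secᵢ p] = p` and the phase of `u a`, `a > 0`, is `u`. [folklore] -/
theorem triv_right_inv (i : Fin (n + 1)) (q : ↥(U i) × Circle) : trivFun i (trivInv i q) = q := by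
  obtain ⟨p, u⟩ := q
  apply Prod.ext
  · apply Subtype.ext
    change proj (act u (sec i p)) = p
    rw [proj_act, proj_sec]
  · have ha : 0 < ‖dirLp i (p : ComplexProjectiveSpace n)‖⁻¹ :=
      inv_pos.2 (norm_pos_iff.2 (dirLp_ne_zero i p.2))
    have e1 : ((act u (sec i p) : unitSphere n) : Vec n) i = (u : ℂ) * ((‖dirLp i (p : ComplexProjectiveSpace n)‖⁻¹ : ℝ) : ℂ) := by
      rw [coe_act]
      change (u : ℂ) * secVec i p i = _
      rw [secVec_apply_self i p.2]
    change phase (((act u (sec i p) : unitSphere n) : Vec n) i) (coord_ne_zero (trivInv i (p, u))) = u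
    rw [phase_congr e1, phase_mul_ofReal u ha]

/-- The trivialisation is continuous. [folklore] -/
theorem continuous_trivFun (i : Fin (n + 1)) : Continuous (trivFun (n := n) i) := by
  refine Continuous.prodMk ?_ ?_
  · exact (proj.continuous.comp continuous_subtype_val).subtype_mk _
  · refine Continuous.subtype_mk ?_ _
    have hz : Continuous fun x : ↥(proj ⁻¹' U i) => ((x : unitSphere n) : Vec n) i :=
      (PiLp.continuous_apply 2 _ i).comp (continuous_subtype_val.comp continuous_subtype_val)
    have hn : Continuous fun x : ↥(proj ⁻¹' U i) => ((‖((x : unitSphere n) : Vec n) i‖ : ℝ) : ℂ) :=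
      continuous_ofReal.comp (continuous_norm.comp hz)
    exact (hn.inv₀ fun x => by exact_mod_cast norm_ne_zero_iff.2 (coord_ne_zero x)).mul hz

/-- Its inverse is continuous. [folklore] -/
theorem continuous_trivInv (i : Fin (n + 1)) : Continuous (trivInv (n := n) i) :=
  (continuous_act.comp (continuous_snd.prodMk ((continuous_sec i).comp continuous_fst))).subtype_mk _

/-- **The local trivialisation of `proj` over `Uᵢ`**, a homeomorphism `proj⁻¹ Uᵢ ≃ₜ Uᵢ × S¹` over
`Uᵢ`. [cite: HatcherAT2002, Example 4.44] -/
def triv (i : Fin (n + 1)) : ↥(proj ⁻¹' U i) ≃ₜ ↥(U (n := n) i) × Circle where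
  toFun := trivFun i
  invFun := trivInv i
  left_inv := triv_left_inv i
  right_inv := triv_right_inv i
  continuous_toFun := continuous_trivFun i
  continuous_invFun := continuous_trivInv i

/-- `triv i` lies over `Uᵢ`. [folklore] -/
theorem triv_fst (i : Fin (n + 1)) (x : ↥(proj ⁻¹' U i)) :
    ((triv i x).1 : ComplexProjectiveSpace n) = proj x := rfl

/-! ### The bundle and its long exact sequence -/

/-- **`S²ⁿ⁺¹ → ℂℙⁿ` is a fibre bundle with fibre `S¹`** (Hatcher 2002, Example 4.44: `n + 1`
charts, the affine chart domains). [cite: HatcherAT2002, Example 4.44] -/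
theorem isFibreBundleWith : IsFibreBundleWith Circle (proj (n := n)) := by
  refine ⟨proj.continuous, fun b => ?_⟩
  obtain ⟨i, hi⟩ := exists_coordNeZero b
  exact ⟨U i, isOpen_setOf_coordNeZero i, hi, triv i, fun _ => rfl⟩

/-- `S²ⁿ⁺¹ → ℂℙⁿ` is a Serre fibration. [cite: HatcherAT2002, Prop. 4.48] -/
theorem isSerreFibration : IsSerreFibration (proj (n := n)) :=
  isFibreBundleWith.isSerreFibration

/-- **The fibres of `proj` are circles.** [cite: HatcherAT2002, Example 4.44] -/
theorem nonempty_fibre_homeomorph (x₀ : unitSphere n) : Nonempty (↥(fibre proj x₀) ≃ₜ Circle) :=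
  isFibreBundleWith.nonempty_fibre_homeomorph (proj x₀)

/-- `π_N` of the fibres vanish for `|N| ≥ 2` (circles). [cite: HatcherAT2002, Prop. 4.1, Example 4.44] -/
theorem subsingleton_homotopyGroup_fibre {N : Type*} [DecidableEq N] [Fintype N] (hN : 2 ≤ Fintype.card N)
    (x₀ : unitSphere n) (a : ↥(fibre proj x₀)) : Subsingleton (HomotopyGroup N ↥(fibre proj x₀) a) := by
  obtain ⟨e⟩ := nonempty_fibre_homeomorph x₀
  haveI := Circle.subsingleton_homotopyGroup hN (e a)
  exact (Equiv.ofBijective _ (bijective_homotopyGroupMap_homeomorph (N := N) e a)).subsingleton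

/-- **`proj_* : π_N(S²ⁿ⁺¹) → π_N(ℂℙⁿ)` is bijective for `|N| ≥ 3`** (long exact sequence with
`πₖ(S¹) = 0`, `k ≥ 2`; Hatcher 2002, p. 380). [cite: HatcherAT2002, Example 4.50, Thm. 4.41] -/
theorem bijective_homotopyGroupMap_proj {N : Type*} [DecidableEq N] [Fintype N] (hN : 3 ≤ Fintype.card N)
    (x₀ : unitSphere n) : Bijective (homotopyGroupMap (N := N) proj x₀) := by
  obtain ⟨s, s', hss'⟩ : ∃ s s' : N, s ≠ s' := Fintype.exists_pair_of_one_lt_card (by omega)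
  haveI : Nonempty N := ⟨s⟩
  haveI : Nonempty { j // j ≠ s } := ⟨⟨s', fun h => hss' h.symm⟩⟩
  have hcard : 2 ≤ Fintype.card { j // j ≠ s } := by
    simp only [ne_eq, Fintype.card_subtype_compl, Fintype.card_subtype_eq]; omega
  exact isSerreFibration.bijective_homotopyGroupMap_of_subsingleton s x₀
    (subsingleton_homotopyGroup_fibre (by omega) x₀ _) (subsingleton_homotopyGroup_fibre hcard x₀ _)

/-- **`proj_* : π_N(S²ⁿ⁺¹) → π_N(ℂℙⁿ)` is one-to-one for `|N| ≥ 2`.** [cite: HatcherAT2002, Example 4.50, Thm. 4.41] -/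
theorem injective_homotopyGroupMap_proj {N : Type*} [DecidableEq N] [Fintype N] (hN : 2 ≤ Fintype.card N)
    (x₀ : unitSphere n) : Injective (homotopyGroupMap (N := N) proj x₀) := by
  obtain ⟨s, s', hss'⟩ : ∃ s s' : N, s ≠ s' := Fintype.exists_pair_of_one_lt_card (by omega)
  haveI : Nonempty N := ⟨s⟩
  haveI := subsingleton_homotopyGroup_fibre hN x₀ (fibreBase proj x₀)
  have hker : ∀ b : HomotopyGroup N (unitSphere n) x₀, homotopyGroupMap (N := N) proj x₀ b = ⟦GenLoop.const⟧ →
      b = ⟦GenLoop.const⟧ := fun b hb => by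
    obtain ⟨c, rfl⟩ := isSerreFibration.exists_homotopyGroupIncl_eq s x₀ b hb
    rw [Subsingleton.elim c ⟦GenLoop.const⟧]
    rfl
  intro a b hab
  have h1 : homotopyGroupMap (N := N) proj x₀ (a⁻¹ * b) = ⟦GenLoop.const⟧ := by
    rw [← coe_homotopyGroupMapHom, map_mul, map_inv, coe_homotopyGroupMapHom, hab, inv_mul_cancel,
      HomotopyGroup.one_def]
  have h2 := hker _ h1
  rw [← HomotopyGroup.one_def] at h2
  exact inv_mul_eq_one.1 h2

/-- `dim_ℝ ℂⁿ⁺¹ = 2n + 2`. [folklore] -/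
theorem finrank_vec : Module.finrank ℝ (Vec n) = 2 * n + 2 := by
  rw [finrank_real_of_complex, finrank_euclideanSpace, Fintype.card_fin]; ring

/-- **`πₖ(S²ⁿ⁺¹) = 0` for `k ≤ 2n`** on the unit sphere of `ℂⁿ⁺¹` (general position,
`subsingleton_homotopyGroup_sphere`). [cite: HatcherAT2002, Cor. 4.9] -/
theorem subsingleton_homotopyGroup_unitSphere {k : ℕ} (hk : k ≤ 2 * n) (x₀ : unitSphere n) :
    Subsingleton (π_ k (unitSphere n) x₀) :=
  subsingleton_homotopyGroup_sphere (by rw [finrank_vec]; omega) x₀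

end CircleBundle

open CircleBundle

/-- **`ℂℙⁿ` is path connected** (the image of the sphere `S²ⁿ⁺¹`; for `n = 0` a point). [folklore] -/
instance instPathConnectedSpace : PathConnectedSpace (ComplexProjectiveSpace n) := by
  rcases Nat.eq_zero_or_pos n with hn | hn
  · -- every point is `[1]`
    subst hn
    have h1 : (fun _ : Fin (0 + 1) => (1 : ℂ)) ≠ 0 := fun h => one_ne_zero (congr_fun h 0)
    have key : ∀ p : ComplexProjectiveSpace 0, p = mk ⟨fun _ => 1, h1⟩ := fun p => by
      induction p using ind with
      | h v =>
        refine (mk_eq_mk_iff _ _).2 ⟨(v : Fin (0 + 1) → ℂ) 0, ?_⟩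
        funext j
        rw [Fin.fin_one_eq_zero j]
        simp
    exact ⟨inferInstance, fun p q => by rw [key p, key q]⟩
  · haveI : PathConnectedSpace (unitSphere n) := by
      rw [← isPathConnected_iff_pathConnectedSpace]
      exact isPathConnected_sphere (by
        rw [← Module.finrank_eq_rank]
        exact_mod_cast (show 1 < Module.finrank ℝ (Vec n) by rw [finrank_vec]; omega)) 0 zero_le_one
    have h := isPathConnected_range (proj (n := n)).continuous
    rw [proj_surjective.range_eq] at h
    exact pathConnectedSpace_iff_univ.2 h

/-- **`πₖ(ℂℙⁿ, p) = 0` for `3 ≤ k ≤ 2n`**, at every base point (Hatcher 2002, p. 380 /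
Example 4.50: `πₖ(ℂPⁿ) ≅ πₖ(S²ⁿ⁺¹) = 0`). [cite: HatcherAT2002, Example 4.50] -/
theorem subsingleton_homotopyGroup {k : ℕ} (h3 : 3 ≤ k) (hk : k ≤ 2 * n)
    (p : ComplexProjectiveSpace n) : Subsingleton (π_ k (ComplexProjectiveSpace n) p) := by
  obtain ⟨x, rfl⟩ := proj_surjective p
  haveI := subsingleton_homotopyGroup_unitSphere hk x
  exact (Equiv.ofBijective _ (bijective_homotopyGroupMap_proj (N := Fin k)
    (by rw [Fintype.card_fin]; exact h3) x)).symm.subsingleton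

/-- **`π₂(ℂℙⁿ, p) ≅ ℤ` for `n ≥ 1`**, at every base point (Hatcher 2002, Example 4.50: the
boundary map `π₂(ℂPⁿ) → π₁(S¹)` of the bundle `S¹ → S²ⁿ⁺¹ → ℂPⁿ` is an isomorphism since
`π₂(S²ⁿ⁺¹) = π₁(S²ⁿ⁺¹) = 0`, and `π₁(S¹) ≅ ℤ`). [cite: HatcherAT2002, Example 4.50] -/
theorem nonempty_mulEquiv_pi_two_int (hn : 1 ≤ n) (p : ComplexProjectiveSpace n) :
    Nonempty (π_ 2 (ComplexProjectiveSpace n) p ≃* Multiplicative ℤ) := by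
  obtain ⟨x₀, rfl⟩ := proj_surjective p
  haveI : Nonempty { j : Fin 2 // j ≠ (0 : Fin 2) } := ⟨⟨1, by decide⟩⟩
  haveI hU : Unique { j : Fin 2 // j ≠ (0 : Fin 2) } :=
    { default := ⟨1, by decide⟩
      uniq := fun j => Subtype.ext (Fin.eq_one_of_ne_zero j.1 j.2) }
  -- `π₂(S²ⁿ⁺¹) = 0` and `π₁(S²ⁿ⁺¹) = 0`
  have hS2 : Subsingleton (HomotopyGroup (Fin 2) (unitSphere n) x₀) :=
    subsingleton_homotopyGroup_unitSphere (by omega) x₀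
  have hS1' : Subsingleton (HomotopyGroup (Fin 1) (unitSphere n) x₀) :=
    subsingleton_homotopyGroup_unitSphere (by omega) x₀
  have hS1 : Subsingleton (HomotopyGroup { j : Fin 2 // j ≠ (0 : Fin 2) } (unitSphere n) x₀) :=
    (homotopyGroupCongr (X := unitSphere n) (x := x₀)
      (Equiv.ofUnique { j : Fin 2 // j ≠ (0 : Fin 2) } (Fin 1))).subsingleton
  -- `∂ : π₂(ℂℙⁿ, [x₀]) → π₁(fibre, x₀)` is bijective
  have hF := isSerreFibration (n := n)
  have hinj : Injective (IsSerreFibration.deltaHom hF (0 : Fin 2) x₀) := by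
    refine (injective_iff_map_eq_one _).2 fun b hb => ?_
    have hb' : IsSerreFibration.delta hF (0 : Fin 2) x₀ b = ⟦GenLoop.const⟧ := by
      rw [← IsSerreFibration.coe_deltaHom, hb, HomotopyGroup.one_def]
    obtain ⟨c, rfl⟩ := IsSerreFibration.exists_proj_eq hF (0 : Fin 2) x₀ b hb'
    rw [Subsingleton.elim (h := hS2) c ⟦GenLoop.const⟧]
    exact congrArg (Quotient.mk _) (GenLoop.ext _ _ fun _ => rfl)
  have hsurj : Surjective (IsSerreFibration.deltaHom hF (0 : Fin 2) x₀) := fun c =>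
    IsSerreFibration.exists_delta_eq hF (0 : Fin 2) x₀ c (Subsingleton.elim (h := hS1) _ _)
  let eδ : HomotopyGroup (Fin 2) (ComplexProjectiveSpace n) (proj x₀) ≃*
      HomotopyGroup { j : Fin 2 // j ≠ (0 : Fin 2) } ↥(fibre (⇑proj) x₀) (fibreBase (⇑proj) x₀) :=
    MulEquiv.ofBijective _ ⟨hinj, hsurj⟩
  -- the fibre is a circle, whose `π₁` is `ℤ`
  obtain ⟨φ⟩ := nonempty_fibre_homeomorph x₀
  let e1 : HomotopyGroup { j : Fin 2 // j ≠ (0 : Fin 2) } ↥(fibre (⇑proj) x₀) (fibreBase (⇑proj) x₀) ≃*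
      HomotopyGroup { j : Fin 2 // j ≠ (0 : Fin 2) } Circle (φ (fibreBase (⇑proj) x₀)) :=
    homotopyGroupMulEquivOfHomeomorph φ (fibreBase (⇑proj) x₀)
  let eIdx : { j : Fin 2 // j ≠ (0 : Fin 2) } ≃ Fin 1 := Equiv.ofUnique _ _
  let e2 : HomotopyGroup { j : Fin 2 // j ≠ (0 : Fin 2) } Circle (φ (fibreBase (⇑proj) x₀)) ≃*
      FundamentalGroup Circle (φ (fibreBase (⇑proj) x₀)) :=
    (homotopyGroupCongrMulEquiv (X := Circle) (x := φ (fibreBase (⇑proj) x₀)) eIdx).trans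
      HomotopyGroup.pi1MulEquivFundamentalGroup
  let e3 : FundamentalGroup Circle (φ (fibreBase (⇑proj) x₀)) ≃* Multiplicative ℤ :=
    Literature.AlgebraicTopology.FundamentalGroup.fundamentalGroupCircleEquiv _
  exact ⟨eδ.trans (e1.trans (e2.trans e3))⟩

end ComplexProjectiveSpace

end Literature.Topology.FourManifolds

end
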